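import Mathlib
import Summits.Ventures.PercRepro2.KPrimeReduction
import Summits.Ventures.PercRepro2.KPrimeLeakLinear
import Summits.Ventures.PercRepro2.KPrimeLeakGlueU
import Summits.Ventures.PercRepro2.KPrimeLeakGlueO1
import Summits.Ventures.PercRepro2.KPrimeLeakUGlue
import Summits.Ventures.PercRepro2.KPrimeLeakGlueHDBase
import Summits.Ventures.PercRepro2.KPrimeLeakGlueHD

/-!
# The unfrozen glue as a comparison of theorems
(blind cell PercRepro2, mine-c g37; `conjectures/MINE-C.md` §46.12 (c))

With `P(Bev) := P(U∩Ω∩Yᶜ) + P((0,1))` (the event `{a₁ ↔ {v, y}} ∩ {a₂ ↮ a₁, v, y}` in its two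
disjoint parts) the E-slope numerator is `Num = P(S)·P(Bev) − P(S∩Yᶜ)·P(U∩Ω)`, and the unfrozen
glue splits EXACTLY (`uGlue_eq_decomp`, a `ring` identity after the two complement relations
`P(U∩Y∩Ω) = P(U∩Ω) − P(U∩Ω∩Yᶜ)`, `P(Y∩S) = P(S) − P(S∩Yᶜ)`) as

  `uGlue = P⁰(S)·P¹¹(S)·bevPiece − bridgePA·P¹¹(U∩Ω)·P⁰(N) − P⁰(S∩Yᶜ)·P¹¹(S)·hPiece`,

with `bevPiece = P¹¹(Bev)·P⁰(N) − P⁰(Bev)·P¹¹(N)` (the growth of the `Bev`-share of `N`),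
`hPiece = P¹¹(U∩Ω)·P⁰(N) − P⁰(U∩Ω)·P¹¹(N)` (the growth of the odds of `a₁ ↔ v` given `a₁ ↮ a₂`)
and `bridgePA` the PA term at the bridge — and ALL THREE ARE THEOREMS: `bevPiece_nonneg`
(`glue_piece_o1` + `glue_piece_hd`), `hPiece_nonneg` (`glue_piece_u`), `bridgePA_nonneg`.  So the
candidate (UGLUE ≥ 0) — and with it (GLUE ≥ 0), `leakGlue_nonneg_of_uGlue_nonneg` — is exactly
the quantitative comparison of theorems `uGlue_nonneg_iff`:
`bridgePA·P¹¹(U∩Ω)·P⁰(N) + P⁰(S∩Yᶜ)·P¹¹(S)·hPiece ≤ P⁰(S)·P¹¹(S)·bevPiece`.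
-/

namespace Summit.Ventures.PercRepro2

namespace KPrime

variable {V : Type*} {E : Type*} [Fintype E] [DecidableEq E] [Fintype V] [DecidableEq V]
  {R : Type*} [Field R] [LinearOrder R] [IsStrictOrderedRing R]

section Defs

variable (ends : E → Sym2 V) (a₁ a₂ v y : V) (p : E → R) (e₁ e₂ : E)

/-- The growth of the `Bev`-share of `N`: `P¹¹(Bev)·P⁰(N) − P⁰(Bev)·P¹¹(N)`,
`P(Bev) = P(U∩Ω∩Yᶜ) + P((0,1))`. -/
noncomputable def bevPiece : R :=
  (prob (Function.update (Function.update p e₂ 1) e₁ 1)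
      (connEvent ends a₁ v ∩ Ω ends a₁ a₂ ∩ (connEvent ends a₂ y)ᶜ) +
    prob (Function.update (Function.update p e₂ 1) e₁ 1) (cls01 ends a₁ a₂ v y)) *
      prob (Function.update p e₂ 0) (N ends a₁ a₂ v) -
  (prob (Function.update p e₂ 0) (connEvent ends a₁ v ∩ Ω ends a₁ a₂ ∩ (connEvent ends a₂ y)ᶜ) +
    prob (Function.update p e₂ 0) (cls01 ends a₁ a₂ v y)) *
      prob (Function.update (Function.update p e₂ 1) e₁ 1) (N ends a₁ a₂ v)

/-- The growth of the odds of `a₁ ↔ v` given `a₁ ↮ a₂`: `P¹¹(U∩Ω)·P⁰(N) − P⁰(U∩Ω)·P¹¹(N)`. -/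
noncomputable def hPiece : R :=
  prob (Function.update (Function.update p e₂ 1) e₁ 1) (connEvent ends a₁ v ∩ Ω ends a₁ a₂) *
      prob (Function.update p e₂ 0) (N ends a₁ a₂ v) -
    prob (Function.update p e₂ 0) (connEvent ends a₁ v ∩ Ω ends a₁ a₂) *
      prob (Function.update (Function.update p e₂ 1) e₁ 1) (N ends a₁ a₂ v)

end Defs

section Identity

variable {ends : E → Sym2 V} {a₁ a₂ v y : V} {p : E → R} {e₁ e₂ : E}

omit [Fintype V] [DecidableEq V] [LinearOrder R] [IsStrictOrderedRing R] in
/-- `P(A ∩ B) = P(A) − P(A ∩ Bᶜ)`. -/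
lemma prob_inter_eq_sub (q : E → R) (A B : Set (Config E)) :
    prob q (A ∩ B) = prob q A - prob q (A ∩ Bᶜ) := by
  exact eq_sub_of_add_eq (prob_inter_add_prob_inter_compl q A B)

omit [Fintype E] [DecidableEq E] [Fintype V] [DecidableEq V] [Field R] [LinearOrder R]
  [IsStrictOrderedRing R] in
/-- `U ∩ Y ∩ Ω = (U ∩ Ω) ∩ Y`. -/
lemma UYΩ_eq : connEvent ends a₁ v ∩ connEvent ends a₂ y ∩ Ω ends a₁ a₂ =
    (connEvent ends a₁ v ∩ Ω ends a₁ a₂) ∩ connEvent ends a₂ y := by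
  ext ω; simp only [Set.mem_inter_iff]; tauto

omit [Fintype E] [DecidableEq E] [Fintype V] [Field R] [LinearOrder R]
  [IsStrictOrderedRing R] in
/-- `Y ∩ S = S ∩ Y`. -/
lemma YS_eq : connEvent ends a₂ y ∩ S ends a₁ a₂ v = S ends a₁ a₂ v ∩ connEvent ends a₂ y :=
  Set.inter_comm _ _

omit [Fintype V] [LinearOrder R] [IsStrictOrderedRing R] in
/-- **The decomposition of the unfrozen glue**:
`uGlue = P⁰(S)·P¹¹(S)·bevPiece − bridgePA·P¹¹(U∩Ω)·P⁰(N) − P⁰(S∩Yᶜ)·P¹¹(S)·hPiece`. -/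
theorem uGlue_eq_decomp :
    uGlue ends a₁ a₂ v y p e₁ e₂ =
      prob (Function.update p e₂ 0) (S ends a₁ a₂ v) *
          prob (Function.update (Function.update p e₂ 1) e₁ 1) (S ends a₁ a₂ v) *
          bevPiece ends a₁ a₂ v y p e₁ e₂ -
        bridgePA ends a₁ a₂ v y p e₁ e₂ *
          prob (Function.update (Function.update p e₂ 1) e₁ 1)
            (connEvent ends a₁ v ∩ Ω ends a₁ a₂) *
          prob (Function.update p e₂ 0) (N ends a₁ a₂ v) -
        prob (Function.update p e₂ 0) (S ends a₁ a₂ v ∩ (connEvent ends a₂ y)ᶜ) *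
          prob (Function.update (Function.update p e₂ 1) e₁ 1) (S ends a₁ a₂ v) *
          hPiece ends a₁ a₂ v p e₁ e₂ := by
  unfold uGlue slopeNum bridgePA bevPiece hPiece
  rw [UYΩ_eq, YS_eq, prob_inter_eq_sub (Function.update p e₂ 0) (connEvent ends a₁ v ∩ Ω ends a₁ a₂),
    prob_inter_eq_sub (Function.update (Function.update p e₂ 1) e₁ 1)
      (connEvent ends a₁ v ∩ Ω ends a₁ a₂),
    prob_inter_eq_sub (Function.update p e₂ 0) (S ends a₁ a₂ v),
    prob_inter_eq_sub (Function.update (Function.update p e₂ 1) e₁ 1) (S ends a₁ a₂ v)]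
  ring

omit [Fintype V] in
/-- **(UGLUE ≥ 0) is exactly a comparison of theorems**:
`0 ≤ uGlue ↔ bridgePA·P¹¹(U∩Ω)·P⁰(N) + P⁰(S∩Yᶜ)·P¹¹(S)·hPiece ≤ P⁰(S)·P¹¹(S)·bevPiece`. -/
theorem uGlue_nonneg_iff :
    0 ≤ uGlue ends a₁ a₂ v y p e₁ e₂ ↔
      bridgePA ends a₁ a₂ v y p e₁ e₂ *
          prob (Function.update (Function.update p e₂ 1) e₁ 1)
            (connEvent ends a₁ v ∩ Ω ends a₁ a₂) *
          prob (Function.update p e₂ 0) (N ends a₁ a₂ v) +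
        prob (Function.update p e₂ 0) (S ends a₁ a₂ v ∩ (connEvent ends a₂ y)ᶜ) *
          prob (Function.update (Function.update p e₂ 1) e₁ 1) (S ends a₁ a₂ v) *
          hPiece ends a₁ a₂ v p e₁ e₂ ≤
      prob (Function.update p e₂ 0) (S ends a₁ a₂ v) *
          prob (Function.update (Function.update p e₂ 1) e₁ 1) (S ends a₁ a₂ v) *
          bevPiece ends a₁ a₂ v y p e₁ e₂ := by
  rw [uGlue_eq_decomp]
  constructor <;> intro h <;> linarith

end Identity

section Theorems

variable {ends : E → Sym2 V} {a₁ a₂ b v y z : V} {e₁ e₂ : E} {p : E → R}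

/-- **The `Bev`-piece is a theorem** (`glue_piece_o1` + `glue_piece_hd`). -/
theorem bevPiece_nonneg (hp : IsProbVec p) (hb : ∀ f, b ∈ ends f → f = e₁ ∨ f = e₂)
    (h₁ : ends e₁ = s(b, a₁)) (h₂ : ends e₂ = s(b, z)) (hne : e₁ ≠ e₂)
    (hba₁ : b ≠ a₁) (hba₂ : b ≠ a₂) (hbv : b ≠ v) (hby : b ≠ y) (hza₂ : z ≠ a₂) (hzv : z ≠ v) :
    0 ≤ bevPiece ends a₁ a₂ v y p e₁ e₂ := by
  have h1 := glue_piece_o1 hp hb h₁ h₂ hne hba₁ hba₂ hbv hby hza₂ hzv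
  have h2 := glue_piece_hd hp hb h₁ h₂ hne hba₁ hba₂ hbv hby
  unfold bevPiece
  nlinarith [h1, h2]

/-- **The odds piece is a theorem** (`glue_piece_u`). -/
theorem hPiece_nonneg (hp : IsProbVec p) (hb : ∀ f, b ∈ ends f → f = e₁ ∨ f = e₂)
    (h₁ : ends e₁ = s(b, a₁)) (h₂ : ends e₂ = s(b, z)) (hne : e₁ ≠ e₂)
    (hba₁ : b ≠ a₁) (hba₂ : b ≠ a₂) (hbv : b ≠ v) :
    0 ≤ hPiece ends a₁ a₂ v p e₁ e₂ := by
  have h := glue_piece_u hp hb h₁ h₂ hne hba₁ hba₂ hbv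
  unfold hPiece
  linarith

end Theorems

end KPrime

end Summit.Ventures.PercRepro2
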